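import Summits.QuantumFields.YangMills.Theorems.BalabanUVNodesN15KingModelMasslessLimit
import Summits.QuantumFields.YangMills.Theorems.BalabanUVNodesN15KingModelReflectionPositivityLaw

/-!
# BalabanUVNodes ∕ N15 — THE KING-MODEL RUNG (PART Ϻ-aa): THE MASSLESS BLOCK FIELD IS REFLECTION POSITIVE — Gaussian laws and exponential moments of field sums under `μ⁰_∞`
# (`∫e^{φ(f)}dμ⁰_∞ = e^{½Σf(z)f(w)S₂^{0}(w−z)}`), covariance reflection positivity of `S₂^{0}` (limit of part Ϸ-k), and OS reflection positivity of the LAW `μ⁰_∞` on the exponential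
# algebra: `∫θF·F dμ⁰_∞ ≥ 0` for `F = Σ_ka_ke^{φ(f_k)}`, `supp f_k ⊆ {z_ν ≥ 0}` (`d + 1 ≥ 3`; Track A, DAG node N15 = NE2; FAN-OUT v1.1 §N15 s3 «KING-MODEL RUNG»; count-neutral)

HONEST FRAMING.  Count-neutral (cell `pub-ymgap`, seat `pub-ymgap-dag-n15-e` g35; `--supports stmt-QuantumFields-27366 --as helper` = K3⁸).  King's `A = 0`, `g = 0` model
([King1986] C. King, Commun. Math. Phys. **102** (1986) 649–677).  Part Ϻ-x built the massless infinite-volume block field `μ⁰_∞ = gaussianFieldOfKernel(S₂^{0}(w−z))` in `d + 1 ≥ 3`.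
This file repeats part Ϻ-o's programme at zero mass: ★ field sums are Gaussian under `μ⁰_∞` with variance `Σf(z)f(w)S₂^{0}(w−z)` and ★★ exponential moments `e^{V∕2}`; ★★ the
covariance reflection positivity `ΣΣc_ic_jS₂^{0}(θz_i − z_j) ≥ 0` (`θz = (z_⊥, −z_ν−1)`, sites in `{z_ν ≥ 0}`) passes to the limit `m ↓ 0` from part Ϸ-k; hence, by Schur's product theorem
for the entrywise exponential (part Ϻ-o), ★★★ **`∫θF·F dμ⁰_∞ ≥ 0`** on the real exponential algebra — OSTERWALDER–SCHRADER POSITIVITY SURVIVES THE MASSLESS LIMIT.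
NOT Bałaban's objects; NOT a node discharge; nothing continuum-Yang–Mills ∕ `ℝ⁴` ∕ OS reconstruction ∕ Clay.  0 `sorry`, 0 def; standard axioms.

WHAT THIS FILE PROVES (kernel).  §1 `hasGaussianLaw_fieldSum0`, `integral_fieldSum0`, `variance_fieldSum0`, ★★ **`integral_exp_fieldSum0`**, `integrable_exp_fieldSum0`.  §2 `kingS2Inf0_refl`,
`kingS2Inf0_reflect_sub_reflect`, `kingS2Inf0_sub_reflect_symm`, ★★ **`kingS2Inf0_reflection_positive`**, ★ `posSemidef_reflectGram0`, ★★★ **`kingFieldInf0_reflection_positive_exp`**.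

HONEST SCOPE.  King's free massless block field at infinite volume, `d + 1 ≥ 3`; observables = finite real-exponential sums of finitely supported field sums.  N15 untouched; counts unmoved.
Locators (use): [King1986] Thm 2.1 (2.22) p.654, Thm 3.3 (3.6) p.655; [GlimmJaffe1987] Thm 6.2.2.
-/

noncomputable section

open scoped BigOperators Topology Matrix
open Filter MeasureTheory ProbabilityTheory Finset

namespace Summit.QuantumFields.YangMills.BalabanUVNodes.N15KingModelRung.InfiniteVolume

open Literature.MathematicalPhysics.QuantumFieldTheory (IsPosSemidefKernel gaussianFieldOfKernel isGaussianProcess_eval_gaussianFieldOfKernel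
  integral_eval_gaussianFieldOfKernel covariance_eval_gaussianFieldOfKernel)
open Summit.QuantumFields.YangMills.BalabanUVNodes.N15KingModelRung.OptimalDecay

variable {d : ℕ}

/-! ## §1 Gaussian laws and exponential moments under `μ⁰_∞` -/

section Moments

variable {J : Type*}

/-- A finite field sum `Σ_{j∈T}c_jφ(p_j)` has Gaussian law under `μ⁰_∞` (`d ≥ 2`). [folklore] -/
theorem hasGaussianLaw_fieldSum0 (hd : 2 ≤ d) (T : Finset J) (p : J → Fin (d + 1) → ℤ) (c : J → ℝ) :
    HasGaussianLaw (fun ω : (Fin (d + 1) → ℤ) → ℝ => ∑ j ∈ T, c j * ω (p j)) (kingFieldInf0 d) := by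
  have hG : IsGaussianProcess (fun (s : Fin (d + 1) → ℤ) (ω : (Fin (d + 1) → ℤ) → ℝ) => ω s) (kingFieldInf0 d) :=
    isGaussianProcess_eval_gaussianFieldOfKernel (isPosSemidefKernel_kingKernel0 hd)
  have h := ((hG.comp_right p).smul c).hasGaussianLaw_fun_sum (I := T)
  have hfun : (fun ω : (Fin (d + 1) → ℤ) → ℝ => ∑ j ∈ T, c j • ((fun (s : Fin (d + 1) → ℤ) (ω' : (Fin (d + 1) → ℤ) → ℝ) => ω' s) ∘ p) j ω)
      = fun ω => ∑ j ∈ T, c j * ω (p j) := by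
    funext ω
    simp only [Function.comp, smul_eq_mul]
  rw [hfun] at h
  exact h

/-- `∫Σ_{j∈T}c_jφ(p_j)dμ⁰_∞ = 0`. [folklore] -/
theorem integral_fieldSum0 (hd : 2 ≤ d) (T : Finset J) (p : J → Fin (d + 1) → ℤ) (c : J → ℝ) :
    ∫ ω, (∑ j ∈ T, c j * ω (p j)) ∂kingFieldInf0 d = 0 := by
  have hG : IsGaussianProcess (fun (s : Fin (d + 1) → ℤ) (ω : (Fin (d + 1) → ℤ) → ℝ) => ω s) (kingFieldInf0 d) :=
    isGaussianProcess_eval_gaussianFieldOfKernel (isPosSemidefKernel_kingKernel0 hd)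
  have hI : ∀ j ∈ T, Integrable (fun ω : (Fin (d + 1) → ℤ) → ℝ => c j * ω (p j)) (kingFieldInf0 d) := fun j _ =>
    ((hG.hasGaussianLaw_eval (p j)).integrable).const_mul (c j)
  rw [integral_finsetSum _ hI]
  refine Finset.sum_eq_zero fun j _ => ?_
  rw [integral_const_mul]
  change c j * ∫ ω, ω (p j) ∂kingFieldInf0 d = 0
  rw [integral_eval_kingFieldInf0 hd, mul_zero]

/-- `Var_{μ⁰_∞}[Σ_{j∈T}c_jφ(p_j)] = Σ_{j,j′}c_jc_{j′}S₂^{0}(p_{j′} − p_j)`. [folklore] -/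
theorem variance_fieldSum0 (hd : 2 ≤ d) (T : Finset J) (p : J → Fin (d + 1) → ℤ) (c : J → ℝ) :
    Var[fun ω : (Fin (d + 1) → ℤ) → ℝ => ∑ j ∈ T, c j * ω (p j); kingFieldInf0 d] = ∑ j ∈ T, ∑ j' ∈ T, c j * c j' * kingS2Inf0 (p j' - p j) := by
  haveI := isProbabilityMeasure_kingFieldInf0 hd
  have hK := isPosSemidefKernel_kingKernel0 hd
  have hG : IsGaussianProcess (fun (s : Fin (d + 1) → ℤ) (ω : (Fin (d + 1) → ℤ) → ℝ) => ω s) (kingFieldInf0 d) :=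
    isGaussianProcess_eval_gaussianFieldOfKernel hK
  have hL2 : ∀ j ∈ T, MemLp (fun ω : (Fin (d + 1) → ℤ) → ℝ => c j * ω (p j)) 2 (kingFieldInf0 d) := fun j _ =>
    ((hG.hasGaussianLaw_eval (p j)).memLp_two).const_mul (c j)
  have h := variance_fun_sum' (μ := kingFieldInf0 d) hL2
  rw [h]
  refine Finset.sum_congr rfl fun j _ => Finset.sum_congr rfl fun j' _ => ?_
  rw [covariance_const_mul_left, covariance_const_mul_right]
  have hc : cov[fun ω : (Fin (d + 1) → ℤ) → ℝ => ω (p j), fun ω => ω (p j'); kingFieldInf0 d] = kingS2Inf0 (p j' - p j) :=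
    covariance_eval_gaussianFieldOfKernel hK (p j) (p j')
  rw [hc]
  ring

/-- ★★ **EXPONENTIAL MOMENTS UNDER `μ⁰_∞`**: `∫exp(Σ_{j∈T}c_jφ(p_j))dμ⁰_∞ = exp(½Σ_{j,j′}c_jc_{j′}S₂^{0}(p_{j′} − p_j))`. [folklore] -/
theorem integral_exp_fieldSum0 (hd : 2 ≤ d) (T : Finset J) (p : J → Fin (d + 1) → ℤ) (c : J → ℝ) :
    ∫ ω, Real.exp (∑ j ∈ T, c j * ω (p j)) ∂kingFieldInf0 d = Real.exp ((∑ j ∈ T, ∑ j' ∈ T, c j * c j' * kingS2Inf0 (p j' - p j)) / 2) := by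
  haveI := isProbabilityMeasure_kingFieldInf0 hd
  have hlaw := (hasGaussianLaw_fieldSum0 hd T p c).map_eq_gaussianReal
  have hmgf := mgf_gaussianReal hlaw 1
  rw [mgf] at hmgf
  simp only [one_mul, one_pow, mul_one] at hmgf
  rw [hmgf, integral_fieldSum0 hd T p c, zero_add, Real.coe_toNNReal _ (variance_nonneg _ _), variance_fieldSum0 hd T p c]

/-- `exp(Σ_{j∈T}c_jφ(p_j))` is `μ⁰_∞`-integrable. [folklore] -/
theorem integrable_exp_fieldSum0 (hd : 2 ≤ d) (T : Finset J) (p : J → Fin (d + 1) → ℤ) (c : J → ℝ) :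
    Integrable (fun ω : (Fin (d + 1) → ℤ) → ℝ => Real.exp (∑ j ∈ T, c j * ω (p j))) (kingFieldInf0 d) := by
  have hY := hasGaussianLaw_fieldSum0 hd T p c
  have hlaw := hY.map_eq_gaussianReal
  have h1 : Integrable (fun y : ℝ => Real.exp y) ((kingFieldInf0 d).map fun ω : (Fin (d + 1) → ℤ) → ℝ => ∑ j ∈ T, c j * ω (p j)) := by
    rw [hlaw]
    have := integrable_exp_mul_gaussianReal (μ := ∫ ω, (∑ j ∈ T, c j * ω (p j)) ∂kingFieldInf0 d)
      (v := (Var[fun ω : (Fin (d + 1) → ℤ) → ℝ => ∑ j ∈ T, c j * ω (p j); kingFieldInf0 d]).toNNReal) 1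
    simpa only [one_mul] using this
  exact (integrable_map_measure h1.aestronglyMeasurable hY.aemeasurable).mp h1

end Moments

/-! ## §2 Reflection positivity of `S₂^{0}` and of the law `μ⁰_∞` -/

section RP

variable (ν : Fin (d + 1))

/-- `S₂^{0}(ρ_μz) = S₂^{0}(z)` (coordinate reflections). [folklore] -/
theorem kingS2Inf0_refl (z : Fin (d + 1) → ℤ) (μ : Fin (d + 1)) : kingS2Inf0 (latReflIdx μ z) = kingS2Inf0 z := by
  unfold kingS2Inf0
  exact iSup_congr fun m => kingS2Inf_refl _ _ _

/-- `S₂^{0}(θz − θw) = S₂^{0}(z − w)`. [folklore] -/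
theorem kingS2Inf0_reflect_sub_reflect (z w : Fin (d + 1) → ℤ) :
    kingS2Inf0 (Function.update z ν (-(z ν) - 1) - Function.update w ν (-(w ν) - 1)) = kingS2Inf0 (z - w) := by
  rw [reflect_sub_reflect, kingS2Inf0_refl]

/-- `S₂^{0}(z − θw) = S₂^{0}(w − θz)`. [folklore] -/
theorem kingS2Inf0_sub_reflect_symm (z w : Fin (d + 1) → ℤ) :
    kingS2Inf0 (z - Function.update w ν (-(w ν) - 1)) = kingS2Inf0 (w - Function.update z ν (-(z ν) - 1)) := by
  rw [sub_reflect_symm, kingS2Inf0_neg, kingS2Inf0_refl]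

/-- ★★ **COVARIANCE REFLECTION POSITIVITY OF `S₂^{0}`**: for sites `z_i` with `(z_i)_ν ≥ 0` and real `c_i`, `Σ_{i,j}c_ic_jS₂^{0}(θz_i − z_j) ≥ 0` (limit `m ↓ 0` of part Ϸ-k; `d ≥ 2`).
[cite: King1986, Thm 3.3 (3.6) p.655, Thm 2.1 (2.22) p.654] -/
theorem kingS2Inf0_reflection_positive (hd : 2 ≤ d) {ι : Type*} (s : Finset ι) (c : ι → ℝ) (z : ι → Fin (d + 1) → ℤ) (hz : ∀ i ∈ s, 0 ≤ z i ν) :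
    0 ≤ ∑ i ∈ s, ∑ j ∈ s, c i * c j * kingS2Inf0 (Function.update (z i) ν (-(z i ν) - 1) - z j) := by
  have ht : Tendsto (fun m2 : ℝ => ∑ i ∈ s, ∑ j ∈ s, c i * c j * kingS2Inf m2 (Function.update (z i) ν (-(z i ν) - 1) - z j)) (𝓝[>] 0)
      (𝓝 (∑ i ∈ s, ∑ j ∈ s, c i * c j * kingS2Inf0 (Function.update (z i) ν (-(z i ν) - 1) - z j))) :=
    tendsto_finsetSum _ fun i _ => tendsto_finsetSum _ fun j _ => (tendsto_kingS2Inf_nhdsGT_zero hd _).const_mul _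
  exact ge_of_tendsto ht (eventually_nhdsWithin_of_forall fun m2 hm2 => kingS2Inf_reflection_positive hm2 ν s c z hz)

variable {ι : Type*} [Fintype ι]

/-- ★ The reflected Gram matrix `M_{kl} = Σ_{z,w∈s}f_k(z)f_l(w)S₂^{0}(w − θz)` is positive semidefinite (`s ⊆ {z_ν ≥ 0}`, `d ≥ 2`). [cite: King1986, Thm 3.3 (3.6) p.655] -/
theorem posSemidef_reflectGram0 (hd : 2 ≤ d) (s : Finset (Fin (d + 1) → ℤ)) (hs : ∀ z ∈ s, 0 ≤ z ν) (f : ι → (Fin (d + 1) → ℤ) → ℝ) :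
    (Matrix.of fun k l : ι => ∑ z ∈ s, ∑ w ∈ s, f k z * f l w * kingS2Inf0 (w - Function.update z ν (-(z ν) - 1))).PosSemidef := by
  refine Matrix.PosSemidef.of_dotProduct_mulVec_nonneg ?_ fun x => ?_
  · ext k l
    simp only [Matrix.conjTranspose_apply, Matrix.of_apply, star_trivial]
    rw [Finset.sum_comm]
    refine Finset.sum_congr rfl fun z _ => Finset.sum_congr rfl fun w _ => ?_
    rw [kingS2Inf0_sub_reflect_symm]
    ring
  · have h := kingS2Inf0_reflection_positive ν hd ((Finset.univ : Finset ι) ×ˢ s) (fun q : ι × (Fin (d + 1) → ℤ) => x q.1 * f q.1 q.2)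
      (fun q : ι × (Fin (d + 1) → ℤ) => q.2) (fun q hq => hs q.2 (Finset.mem_product.mp hq).2)
    simp_rw [Finset.sum_product] at h
    have e : star x ⬝ᵥ (Matrix.of (fun k l : ι => ∑ z ∈ s, ∑ w ∈ s, f k z * f l w * kingS2Inf0 (w - Function.update z ν (-(z ν) - 1)))).mulVec x
        = ∑ k, ∑ l, ∑ z ∈ s, ∑ w ∈ s,
            x k * f k z * (x l * f l w) * kingS2Inf0 (Function.update z ν (-(z ν) - 1) - w) := by
      simp only [star_trivial, dotProduct, Matrix.mulVec, Matrix.of_apply, Finset.mul_sum, Finset.sum_mul]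
      refine Finset.sum_congr rfl fun k _ => Finset.sum_congr rfl fun l _ => Finset.sum_congr rfl fun z _ => Finset.sum_congr rfl fun w _ => ?_
      rw [← kingS2Inf0_neg (Function.update z ν (-(z ν) - 1) - w), neg_sub]
      ring
    rw [e]
    refine le_trans h (le_of_eq (Finset.sum_congr rfl fun k _ => Finset.sum_comm))

/-- ★★★ **REFLECTION POSITIVITY OF THE MASSLESS LAW `μ⁰_∞` ON THE EXPONENTIAL ALGEBRA** (`d + 1 ≥ 3`): with `θz = (z_⊥, −z_ν − 1)`, `s ⊆ {z_ν ≥ 0}` finite, `f_k` real test functions on `s`,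
`a_k` real: `0 ≤ ∫ (Σ_ka_ke^{Σ_{z∈s}f_k(z)φ(θz)})(Σ_la_le^{Σ_{z∈s}f_l(z)φ(z)}) dμ⁰_∞`. [cite: King1986, Thm 2.1 (2.22) p.654, Thm 3.3 (3.6) p.655; GlimmJaffe1987, Thm 6.2.2] -/
theorem kingFieldInf0_reflection_positive_exp (hd : 2 ≤ d) (s : Finset (Fin (d + 1) → ℤ)) (hs : ∀ z ∈ s, 0 ≤ z ν) (f : ι → (Fin (d + 1) → ℤ) → ℝ) (a : ι → ℝ) :
    0 ≤ ∫ ω, (∑ k, a k * Real.exp (∑ z ∈ s, f k z * ω (Function.update z ν (-(z ν) - 1)))) * (∑ l, a l * Real.exp (∑ z ∈ s, f l z * ω z)) ∂kingFieldInf0 d := by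
  set θ : (Fin (d + 1) → ℤ) → (Fin (d + 1) → ℤ) := fun z => Function.update z ν (-(z ν) - 1) with hθ
  set V : ι → ℝ := fun k => ∑ z ∈ s, ∑ w ∈ s, f k z * f k w * kingS2Inf0 (w - z) with hV
  set M : Matrix ι ι ℝ := Matrix.of fun k l => ∑ z ∈ s, ∑ w ∈ s, f k z * f l w * kingS2Inf0 (w - θ z) with hM
  have hterm : ∀ k l, ∫ ω, Real.exp (∑ z ∈ s, f k z * ω (θ z)) * Real.exp (∑ z ∈ s, f l z * ω z) ∂kingFieldInf0 d
      = Real.exp (V k / 2) * Real.exp (V l / 2) * Real.exp (M k l) := by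
    intro k l
    set p : Bool × (Fin (d + 1) → ℤ) → (Fin (d + 1) → ℤ) := fun q => if q.1 then θ q.2 else q.2 with hp
    set c : Bool × (Fin (d + 1) → ℤ) → ℝ := fun q => if q.1 then f k q.2 else f l q.2 with hc
    have hsplit : ∀ ω : (Fin (d + 1) → ℤ) → ℝ, ∑ q ∈ Finset.univ ×ˢ s, c q * ω (p q) = (∑ z ∈ s, f k z * ω (θ z)) + ∑ z ∈ s, f l z * ω z := by
      intro ω
      rw [Finset.sum_product, Fintype.sum_bool]
      simp [hp, hc]
    have hexp : (fun ω : (Fin (d + 1) → ℤ) → ℝ => Real.exp (∑ z ∈ s, f k z * ω (θ z)) * Real.exp (∑ z ∈ s, f l z * ω z))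
        = fun ω => Real.exp (∑ q ∈ Finset.univ ×ˢ s, c q * ω (p q)) := by
      funext ω; rw [hsplit, Real.exp_add]
    rw [hexp, integral_exp_fieldSum0 hd, ← Real.exp_add, ← Real.exp_add]
    congr 1
    rw [Finset.sum_product, Fintype.sum_bool]
    simp only [Finset.sum_product, Fintype.sum_bool, hp, hc, if_true, Bool.false_eq_true, if_false, Finset.sum_add_distrib]
    have hAA : ∑ z ∈ s, ∑ w ∈ s, f k z * f k w * kingS2Inf0 (θ w - θ z) = V k := by
      refine Finset.sum_congr rfl fun z _ => Finset.sum_congr rfl fun w _ => ?_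
      rw [hθ, kingS2Inf0_reflect_sub_reflect]
    have hAB : ∑ z ∈ s, ∑ w ∈ s, f k z * f l w * kingS2Inf0 (w - θ z) = M k l := by rw [hM]; rfl
    have hBA : ∑ z ∈ s, ∑ w ∈ s, f l z * f k w * kingS2Inf0 (θ w - z) = M k l := by
      rw [hM, Matrix.of_apply, Finset.sum_comm]
      refine Finset.sum_congr rfl fun z _ => Finset.sum_congr rfl fun w _ => ?_
      rw [← kingS2Inf0_neg (θ z - w), neg_sub]
      ring
    have hBB : ∑ z ∈ s, ∑ w ∈ s, f l z * f l w * kingS2Inf0 (w - z) = V l := rfl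
    rw [hAA, hAB, hBA, hBB]
    ring
  have hint : ∀ k l, Integrable (fun ω : (Fin (d + 1) → ℤ) → ℝ => a k * Real.exp (∑ z ∈ s, f k z * ω (θ z)) * (a l * Real.exp (∑ z ∈ s, f l z * ω z))) (kingFieldInf0 d) := by
    intro k l
    set p : Bool × (Fin (d + 1) → ℤ) → (Fin (d + 1) → ℤ) := fun q => if q.1 then θ q.2 else q.2 with hp
    set c : Bool × (Fin (d + 1) → ℤ) → ℝ := fun q => if q.1 then f k q.2 else f l q.2 with hc
    have hI := (integrable_exp_fieldSum0 hd (Finset.univ ×ˢ s) p c).const_mul (a k * a l)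
    refine hI.congr (Eventually.of_forall fun ω => ?_)
    simp only
    rw [Finset.sum_product, Fintype.sum_bool]
    simp only [hp, hc, if_true, Bool.false_eq_true, if_false, Real.exp_add]
    ring
  have hexp : (fun ω : (Fin (d + 1) → ℤ) → ℝ => (∑ k, a k * Real.exp (∑ z ∈ s, f k z * ω (θ z))) * (∑ l, a l * Real.exp (∑ z ∈ s, f l z * ω z)))
      = fun ω => ∑ k, ∑ l, a k * Real.exp (∑ z ∈ s, f k z * ω (θ z)) * (a l * Real.exp (∑ z ∈ s, f l z * ω z)) := by
    funext ω; rw [Finset.sum_mul_sum]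
  rw [hexp, integral_finsetSum _ fun k _ => integrable_finsetSum _ fun l _ => hint k l]
  simp_rw [integral_finsetSum _ fun l _ => hint _ l]
  have hkl : ∀ k l, ∫ ω, a k * Real.exp (∑ z ∈ s, f k z * ω (θ z)) * (a l * Real.exp (∑ z ∈ s, f l z * ω z)) ∂kingFieldInf0 d
      = (a k * Real.exp (V k / 2)) * Real.exp (M k l) * (a l * Real.exp (V l / 2)) := by
    intro k l
    have e : (fun ω : (Fin (d + 1) → ℤ) → ℝ => a k * Real.exp (∑ z ∈ s, f k z * ω (θ z)) * (a l * Real.exp (∑ z ∈ s, f l z * ω z)))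
        = fun ω => (a k * a l) * (Real.exp (∑ z ∈ s, f k z * ω (θ z)) * Real.exp (∑ z ∈ s, f l z * ω z)) := by
      funext ω; ring
    rw [e, integral_const_mul, hterm]
    ring
  simp_rw [hkl]
  have hPSD : (Matrix.of fun k l : ι => Real.exp (M k l)).PosSemidef := posSemidef_entrywiseExp (posSemidef_reflectGram0 ν hd s hs f)
  have hq := hPSD.dotProduct_mulVec_nonneg (fun k => a k * Real.exp (V k / 2))
  have e : star (fun k => a k * Real.exp (V k / 2)) ⬝ᵥ (Matrix.of (fun k l : ι => Real.exp (M k l))).mulVec (fun k => a k * Real.exp (V k / 2))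
      = ∑ k, ∑ l, (a k * Real.exp (V k / 2)) * Real.exp (M k l) * (a l * Real.exp (V l / 2)) := by
    simp only [star_trivial, dotProduct, Matrix.mulVec, Matrix.of_apply, Finset.mul_sum]
    refine Finset.sum_congr rfl fun k _ => Finset.sum_congr rfl fun l _ => ?_
    ring
  rw [e] at hq
  exact hq

end RP

end Summit.QuantumFields.YangMills.BalabanUVNodes.N15KingModelRung.InfiniteVolume
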